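import Mathlib

/-!
# Tier4/LitWitness — Liu's Albanese decomposition of a unitary Shimura variety, AS PRINTED (named Props, no proofs)

Blind re-derivation cell `pub-hodge-repro`, Tier 4, literature seat `t4-lit-5` (gen 0).  Tree path
`lean/Summits/Ventures/HodgeRepro/Tier4/LitWitness.lean` (HOME copy `lit/t4/Tier4LitWitness.lean`).
Imports: Mathlib only.  NOTHING is proved here (seat rule: printed theorems are typed as named Props with their
hypotheses explicit; a line that consumes one displays it as a hypothesis of a LEMMA, never of `P_T4`).

## Source (read on the materialised page files; paper rows I-t4-lit-5-1 … I-t4-lit-5-10 of proofs/t4/inputs/t4-lit-5.md)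
[L21] Y. Liu, *Fourier–Jacobi cycles and arithmetic relative trace formula* (with an appendix by C. Li and Y. Zhu),
Cambridge J. Math. 9 (2021), no. 1, 1–147, doi:10.4310/cjm.2021.v9.n1.a1 — the JOURNAL PRINT is held: store key
`paper:liu2021-fourier-jacobi-cycles-arithmetic-relative-trace-formula` (147 pages, born-digital text layer, store page
= printed page); every locator below is a PRINT locator «p. N Lk» (deposit rows I-t4-lit-5-26 … -30).  The arXiv TeX
layer `paper:arxiv-2102.11518` (rows 1–10) was read first; the print differs only in notation (the third component of
an oscillator triple is `χ` in print, `ν` on the arXiv layer; the category of CM data is `𝒜(μ)`; in §4 the print writes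
`G` for `U(V)`) and in one citation — ERRATUM (row I-t4-lit-5-E1): Remark 4.14 cites `[GR91, Rog92]`, i.e. Gelbart–Rogawski,
Invent. Math. 105 (1991), not `[Rog90]` as the truncated arXiv layer suggested.

Setting as printed (§1.1, print p. 4 L35 – p. 5 L12): `E/F` a CM extension, `n ≥ 2`; `V` a totally positive definite INCOHERENT
hermitian space over `𝔸_E` of rank `n`; `{Sh(V)_K}_K` the system of Shimura varieties indexed by sufficiently small
open compact `K ⊆ U(V)(𝔸_F^∞)`, each smooth of dimension `n − 1` over `Spec E`; `X_K` the canonical smooth toroidal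
compactification (`= Sh(V)_K` when proper); `A_K` the Albanese variety of `X_K`, `A_∞ = lim_K A_K`; for every conjugate
symplectic automorphic character `μ` of `𝔸_E^×` of weight one a number field `M_μ ⊆ ℂ` and an abelian variety `A_μ`
over `E` with CM by `M_μ`, unique up to isogeny, `dim A_μ = [M_μ : ℚ]/2`; `Ω(μ) := Hom_E(A_∞, A_μ)_ℚ`.
Adèlic oscillator triples `(μ, ε, χ)` (Def 4.11, print p. 46 L32–L62) and `μ`-admissibility of `ε` (Def 4.12,
print p. 47 L5–L9); `ω(μ, ε, χ)` the irreducible admissible representation of `U(V)(𝔸_F^∞)` attached to a triple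
(the restricted tensor product of the local oscillator representations of Appendix D.1, print p. 125 L9–L27).
In the Tier-4 witness (TIER3.md §1 item 3) `n = 3`, `X = X_K` is a compact Picard modular surface and the four
corners of the face are meant to be factors `A_μ` of `A_K` by Cor 4.20 — «UNCONDITIONAL at n = 3» by Rem 4.14.

## The interface
`AlbaneseData` carries the objects the statements quantify over: levels `K` with the predicate «sufficiently small»,
the characters `μ`, the Galois-orbit relation, the triples with their projection to `μ`, the `ℂ[U(V)(𝔸_F^∞)]`-modules
(up to isomorphism) with a direct-sum operation over a set of triples, the Betti `H^1` of `A_∞` at an embedding `τ′`,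
`Ω(μ) ⊗ ℂ`, and the isogeny classes of abelian varieties over `E` as a commutative monoid under product
(`A ∼ B × C` is the equation `A = B * C` in the monoid of isogeny classes; `A^d = A ^ d`), with the dimension as an
additive function.  What the interface does NOT encode (a consumer matches it by hand): that `Level` really indexes
the Shimura varieties of (P)'s `X`, that `AbVar` is the isogeny monoid over `E`, that `H1 τ′` is Betti cohomology —
each field's docstring says what it stands for on the page.
-/

set_option autoImplicit false

noncomputable section

namespace Summit.Ventures.HodgeRepro.Tier4.Lit

/-- The data of [L21] §1.1 / §4 (see the module docstring).
* `n` — the rank of `V` (the Shimura varieties have dimension `n − 1`; the witness has `n = 3`).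
* `Level`, `Small K` — the open compact subgroups `K ⊆ U(V)(𝔸_F^∞)` and «sufficiently small».
* `Char` — the conjugate symplectic automorphic characters of `𝔸_E^×` of WEIGHT ONE (Def 4.3); `sameOrbit μ μ′` —
  `μ` and `μ′` lie in one `Gal(ℂ/ℚ)`-orbit (the product of Cor 4.20 runs over orbit representatives).
* `degM μ` — `[M_μ : ℚ]` (print p. 5 L10–L11: `A_μ` has dimension `[M_μ : ℚ]/2`).
* `Triple`, `chr t` — the adèlic oscillator triples `(μ, ε, ν)` (Def 4.11) and the projection to `μ`;
  `Admissible t` — «`ε` is `μ`-admissible» (Def 4.12).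
* `Rep`, `Iso` — the `ℂ[U(V)(𝔸_F^∞)]`-modules and isomorphism; `omega t` — `ω(μ, ε, ν)`; `dsum S` — the direct sum
  `⊕_{t ∈ S} ω(t)`; `H1 τ′` — `H^1_{B,τ′}(A_∞, ℂ)` (print p. 46 L25–L30: `H^1_{B,τ′}(A_∞, ℂ) := lim_→K H^1_{B,τ′}(A_K, ℂ)`, an admissible representation of `G(𝔸_F^∞)`) at an embedding `τ′ : E → ℂ` (`Emb`);
  `OmegaC μ` — `Ω(μ) ⊗_{M_μ} ℂ`.
* `AbVar` (parameter, a commutative monoid) — isogeny classes of abelian varieties over `E` under product;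
  `A K` — the class of the Albanese `A_K`; `Amu μ` — the class of `A_μ`; `dim` — the dimension.
* `d μ K` — `d(μ, K) := Σ_ε Σ_ν dim ω(μ, ε, ν)^K`, the sum over all `ε, ν` with `ε` `μ`-admissible (Cor 4.20). -/
structure AlbaneseData (AbVar : Type) [CommMonoid AbVar] where
  n : ℕ
  Level : Type
  Small : Level → Prop
  Char : Type
  sameOrbit : Char → Char → Prop
  degM : Char → ℕ
  Triple : Type
  chr : Triple → Char
  Admissible : Triple → Prop
  Rep : Type
  Iso : Rep → Rep → Prop
  omega : Triple → Rep
  dsum : Set Triple → Rep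
  Emb : Type
  H1 : Emb → Rep
  OmegaC : Char → Rep
  A : Level → AbVar
  Amu : Char → AbVar
  dim : AbVar → ℕ
  d : Char → Level → ℕ

variable {AbVar : Type} [CommMonoid AbVar]

/-- **[L21] §1.1 set-up, print p. 5 L10–L11**: «In particular, `A_μ` has dimension `[M_μ : ℚ]/2`» — `2 · dim A_μ = [M_μ : ℚ]`. -/
def Liu2021_dim_Amu (D : AlbaneseData AbVar) : Prop :=
  ∀ μ : D.Char, 2 * D.dim (D.Amu μ) = D.degM μ

/-- **[L21] Proposition 4.13** (print p. 47 L10–L22), VERBATIM: «Suppose that `n ⩾ 3`. Then for every embedding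
`τ′ : E → ℂ`, there is an isomorphism `H^1_{B,τ′}(A_∞, ℂ) ≃ ⊕_{(μ,ε,χ)} ω(μ, ε, χ)` of `ℂ[G(𝔸_F^∞)]`-modules, where
the direct sum is taken over all adèlic oscillator triples in which `μ` is of weight one and `ε` is `μ`-admissible.»
(`Char` already consists of the weight-one characters, so the index set is `{t | Admissible t}`.)
Remark 4.14 (print p. 49 L35–L36): «When `n = 3`, Proposition 4.13 can be deduced from [GR91, Rog92].» -/
def Liu2021_Prop4_13 (D : AlbaneseData AbVar) : Prop :=
  3 ≤ D.n → ∀ τ' : D.Emb, D.Iso (D.H1 τ') (D.dsum {t : D.Triple | D.Admissible t})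

/-- **[L21] Proposition 4.13, the multiplicity-one conclusion of its proof** (print p. 49 L22–L34): «we have shown that
if an irreducible admissible representation `π` of `G(𝔸)` contributes to the Albanese, then `π^∞ ≃ ω(μ, ε, χ)` for a
unique adèlic oscillator triple in which `μ` is of weight one and `ε` is `μ`-admissible, and `m_disc(π) = 1`.
Conversely, for every such adèlic oscillator triple `(μ, ε, χ)`, there exists a pair `(W, π_W)`, unique up to
isomorphism, such that if we denote by `π` an irreducible subrepresentation of `Θ^V_{(μ,ν),W}(π_W)`, then `ω(μ, ε, χ)` is
isomorphic to `π^∞` and `H^1(𝔤, K_G; π_∞) ≠ {0}`. … the dimension of `H^1_{B,τ′}(A_∞, ℂ)[ω(μ, ε, χ)]` is `1`.»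
(Case 1 of the proof, print p. 48 L19–L56, names the archimedean components: `π_{∞1} ≃ ω_{n−1,1}^{m_1,±,1}` at the
distinguished place and `π_{∞i} ≃ ω_{n,0}^{m_i,±,1}` at the definite places, `(m_1, …, m_d)` the weight of `μ` — deposit
row I-t4-lit-5-30.)  Typed as the statement that
the summands of Prop 4.13 are pairwise non-isomorphic (so each `ω(t)` occurs in `H^1` with multiplicity exactly one);
the theta-lift origin `π ⊂ θ^V_{(μ,ν),W}(π_W)` of the `ω(μ, ε, ν)`-part is NOT typed (no theta correspondence in the
interface) — a line that needs «the `ω(μ,ε,ν)`-isotypic `H^1` of `X_K` IS the theta lift from the line `W`» must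
display it as its own hypothesis. -/
def Liu2021_Prop4_13_multiplicityOne (D : AlbaneseData AbVar) : Prop :=
  3 ≤ D.n → ∀ t t' : D.Triple, D.Admissible t → D.Admissible t' → t ≠ t' → ¬ D.Iso (D.omega t) (D.omega t')

/-- **[L21] Theorem 4.18, first sentence and item (2)** (print p. 52 L37–L62): «There is an isomorphism
`Ω(μ) ⊗_{M_μ} ℂ ≃ ⊕_ε ⊕_χ ω(μ, ε, χ)` of `ℂ[G(𝔸_F^∞)]`-modules, where the direct sum is taken over all `ε, χ` such
that `ε` is `μ`-admissible. Moreover, … (2) The `ℂ[G(𝔸_F^∞)]`-modules in the direct sum in Theorem 4.18 are mutually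
non-isomorphic.»  (Item (1), `Ω(μ)^K ≃ Hom_E(A_K, A_μ)_ℚ` for sufficiently small `K ⊆ G(𝔸_F^∞)`, and item (3), the
`Gal(ℂ/M_μ)`-stability of `⊕_χ ω(μ, ε, χ)`, are not typed — no `K`-invariants and no Galois action in the interface.)
The theorem is stated under the standing `n ≥ 2` of §1.1; Thm 1.1 / Cor 4.20 distinguish `n ≥ 3` from `n = 2`
only for the Albanese decomposition. -/
def Liu2021_Thm4_18 (D : AlbaneseData AbVar) : Prop :=
  ∀ μ : D.Char, D.Iso (D.OmegaC μ) (D.dsum {t : D.Triple | D.chr t = μ ∧ D.Admissible t}) ∧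
    ∀ t t' : D.Triple, D.chr t = μ → D.chr t' = μ → D.Admissible t → D.Admissible t' → t ≠ t' →
      ¬ D.Iso (D.omega t) (D.omega t')

/-- A finite set `S` of characters is a system of representatives of the `Gal(ℂ/ℚ)`-orbits: every character lies in
the orbit of exactly one member of `S`. -/
def AlbaneseData.IsOrbitReps (D : AlbaneseData AbVar) (S : Finset D.Char) : Prop :=
  ∀ μ : D.Char, ∃! μ' : D.Char, μ' ∈ S ∧ D.sameOrbit μ μ'

/-- **[L21] Corollary 4.20, the case `n ⩾ 3`** (print p. 54 L49 – p. 55 L20), VERBATIM: «Take an arbitrary object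
`D_μ = (A_μ, i_μ, λ_μ, r_μ) ∈ 𝒜(μ)`. For every sufficiently small open compact subgroup `K` of `G(𝔸^∞_F)`, there is
an isogeny decomposition `A_K ∼ ∏_μ A_μ^{d(μ,K)}`, resp. `A_K^end ∼ ∏_μ A_μ^{d(μ,K)}` of abelian varieties over `E`
when `n ⩾ 3` (resp. `n = 2`), where the product is taken over representatives of `Gal(ℂ/ℚ)`-orbits of all conjugate
symplectic automorphic characters of `𝔸_E^×` of weight one. Here, `A_K^end` is the endoscopic part of `A_K` when
`n = 2`, defined in (D.3), and `d(μ, K) := Σ_ε Σ_χ dim_ℂ ω(μ, ε, χ)^K`, where the sum is taken over all `ε, χ` such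
that `ε` is `μ`-admissible. It is clear that the integer `d(μ, K)` depends only on the `Gal(ℂ/ℚ)`-orbit of `μ`.
Proof. This is a direct consequence of Theorem 4.18.»
Typed in the monoid of isogeny classes: for `n ≥ 3` and every sufficiently small `K` there is a FINITE system `S` of
orbit representatives with `A_K = ∏_{μ ∈ S} A_μ ^ d(μ, K)` (the page's product is over all orbits; all but finitely
many exponents vanish for a given `K` since `A_K` has finite dimension — the `Finset` reading), and `d(μ, K)` is
constant on orbits.  The `n = 2` clause (endoscopic part) is NOT typed. -/
def Liu2021_Cor4_20 (D : AlbaneseData AbVar) : Prop :=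
  3 ≤ D.n →
    (∀ K : D.Level, D.Small K → ∃ S : Finset D.Char, D.IsOrbitReps S ∧
        D.A K = ∏ μ ∈ S, D.Amu μ ^ D.d μ K) ∧
    (∀ (μ μ' : D.Char) (K : D.Level), D.sameOrbit μ μ' → D.d μ K = D.d μ' K)

/-- The consequence of Cor 4.20 a witness construction reads off it (stated separately so that a line can name the
exact step): if `d(μ, K) ≥ 1` then `A_μ` is an isogeny factor of `A_K` — there is a class `B` with `A_K = A_μ * B`.
This is the monoid reading of «`A_μ` appears in the isogeny decomposition of `A_K`»; it is implied by
`Liu2021_Cor4_20` by pulling one factor out of the product — a consumer must supply the orbit bookkeeping: the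
page's product runs over orbit REPRESENTATIVES, so the factor exhibited is `A_{μ′}` for the representative `μ′` of
the orbit of `μ` (and `d(μ′, K) = d(μ, K)` by the last sentence of the corollary). -/
def Liu2021_Cor4_20_factor (D : AlbaneseData AbVar) : Prop :=
  3 ≤ D.n → ∀ (K : D.Level) (μ : D.Char), D.Small K → 1 ≤ D.d μ K →
    ∃ (μ' : D.Char) (B : AbVar), D.sameOrbit μ μ' ∧ D.A K = D.Amu μ' * B

/-! ## Appendix D.1 of [L21]: the local oscillator representations (print p. 125 L9 – p. 126 L15; deposit rows
I-t4-lit-5-27 / -28).  Construction in three steps (p. 125 L16–L27): `ε ∈ E^{−×}/N_{E/F}E^×` makes `V_ε` symplectic and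
gives the oscillator representation `ω(ε)` of `Mp(V_ε)` for `ψ_F`; a character `μ` of `E^×` with `μ|_{F^×}` the
quadratic character gives `ι_μ : U(V) → Mp(V_ε)` and `ω(μ, ε) := ω(ε) ∘ ι_μ`; `ω(μ, ε, χ)` is the maximal quotient with
central character `χ : E^1 → ℂ^1`.  `LocalOscillatorData` carries the places, the local triples, the local
representations with isomorphism / irreducibility / admissibility, and — at a place split in `E` — the unitarily
induced representation the lemma identifies `ω(μ, ε, χ)` with. -/

/-- The local data of [L21] Appendix D.1 (see the section docstring).
* `Place`, `IsNonarch v`, `IsSplit v` — the places of `F`, «`F_v` nonarchimedean», «`E_v = F_v × F_v`».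
* `Triple v` — the local parameters `(μ_v, ε_v, χ_v)` of Steps 1–3; `Rep v`, `Iso`, `IsIrreducible`, `IsAdmissible`.
* `omega v t` — `ω(μ_v, ε_v, χ_v)`.
* `inducedQ v t` — at a split `v` (where `U(V)(F_v) ≅ GL_n(F_v)`, `μ_v = ν ⊠ ν^{−1}`): «the unitary induction from
  `Q_{n−1,1}(F_v)` to `GL_n(F_v)` of the (unitary) character `(ν ∘ det) χ ν^{1−n}` of `GL_{n−1}(F_v) × GL_1(F_v)`»
  (p. 126 L8–L15; `Q_{n−1,1}` the standard parabolic with Levi `GL_{n−1} × GL_1`). -/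
structure LocalOscillatorData where
  n : ℕ
  Place : Type
  IsNonarch : Place → Prop
  IsSplit : Place → Prop
  Triple : Place → Type
  Rep : Place → Type
  Iso : ∀ v, Rep v → Rep v → Prop
  IsIrreducible : ∀ v, Rep v → Prop
  IsAdmissible : ∀ v, Rep v → Prop
  omega : ∀ v, Triple v → Rep v
  inducedQ : ∀ v, Triple v → Rep v

/-- **[L21] Lemma D.1, first sentence** (print p. 125 L28–L29): «Suppose that `F` is nonarchimedean. Then `ω(μ, ε, χ)` is
irreducible and admissible.» -/
def Liu2021_LemmaD1_irreducible (D : LocalOscillatorData) : Prop :=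
  ∀ (v : D.Place), D.IsNonarch v → ∀ t : D.Triple v,
    D.IsIrreducible v (D.omega v t) ∧ D.IsAdmissible v (D.omega v t)

/-- **[L21] Lemma D.1 (3)** (print p. 125 L33–L34): «If `n ⩾ 3`, then `ω(μ′, ε′, χ′)` is isomorphic to `ω(μ, ε, χ)` if
and only if `(μ′, ε′, χ′) = (μ, ε, χ)`.» (`F` nonarchimedean, the standing hypothesis of the lemma.) -/
def Liu2021_LemmaD1_3 (D : LocalOscillatorData) : Prop :=
  3 ≤ D.n → ∀ (v : D.Place), D.IsNonarch v → ∀ t t' : D.Triple v,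
    D.Iso v (D.omega v t) (D.omega v t') ↔ t = t'

/-- **[L21] Lemma D.1, proof, the split case** (print p. 126 L8–L15): «We consider first the case where `E = F × F`.
We identify `U(V)` with `GL_n(F)` and `E^−` with `F` through the first factor; and write `μ = ν ⊠ ν^{−1}`. Note that the
first component of `χ̌` is simply `χ`. Let `Q_{n−1,1}` be the standard parabolic subgroup of `GL_n` whose Levi is
`GL_{n−1} × GL_1`. Then `ω(μ, ε, χ)` is isomorphic to the unitary induction from `Q_{n−1,1}(F)` to `GL_n(F)` of the
(unitary) character `(ν ∘ det) χ ν^{1−n}` of `GL_{n−1}(F) × GL_1(F)` (hence of `Q_{n−1,1}(F)`). See for example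
[GR90, 2.6].»  Typed: at every nonarchimedean place split in `E`, `ω(μ_v, ε_v, χ_v) ≅ inducedQ v t`. -/
def Liu2021_LemmaD1_split (D : LocalOscillatorData) : Prop :=
  ∀ (v : D.Place), D.IsNonarch v → D.IsSplit v → ∀ t : D.Triple v, D.Iso v (D.omega v t) (D.inducedQ v t)


/-! ## v3 (2026-08-28, seat t4-lit-5 gen 1; answering t4-plan-3 S12509 for L3.3e `euler_nonvanishing` / `HasLocaliser`)
Lemma D.1 (1) and the `⊕_χ` display of its proof, AS PRINTED (deposit rows I-t4-lit-5-27, -28, -53; print p. 125 L24–L29,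
p. 126 L22–L27).  `LocalOscillatorData` and the three Props above are UNCHANGED (landed, consumed by name); the two new
predicates quantify over an EXTENSION of the data.  Nothing is proved about the page: the one `theorem` below is the
arithmetic consequence «`n ≥ 3 ⇒ ω(μ, ε, χ) ≠ 0`» of the typed iff. -/

/-- The local data of Appendix D.1 extended by what Lemma D.1 (1) and the `⊕_χ` display quantify over.
* `IsZero v r` — «`ω(μ, ε, χ)` is zero» (the zero representation of `U(V)(F_v)`).
* `IsFieldAt v` — «`E` is a field» at `v` (`E_v := E ⊗_F F_v` a field: `v` inert or ramified in `E`); the page states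
  it as its own condition, so it is its own predicate (not defined as `¬ IsSplit v`).
* `IsAnisotropicAt v` — «`V` is anisotropic» over `F_v`.
* `chiCheckEqMuSq v t` — «`χ̌ = μ²`» for the triple `t = (μ, ε, χ)`, where `χ̌(x) := χ(x/x^c)` (print p. 125 L26–L27).
* `Pair v`, `pairOf v t` — the pairs `(μ, ε)` of Steps 1–2 and the projection of a triple to its pair;
  `CentralChar v`, `withChar v p χ` — the characters `χ : E^1 → ℂ^1` of Step 3 and the triple `(μ, ε, χ)` with pair
  `p = (μ, ε)` and character `χ` (the compatibility `withChar v (pairOf v t) χ = t` for the `χ` of `t` is NOT imposed —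
  a consumer matches it by hand).
* `omegaPair v p` — `ω(μ, ε) := ω(ε) ∘ ι_μ` (Step 2, print p. 125 L21–L23), the representation of `U(V)(F_v)` BEFORE
  the central-character quotient of Step 3.
* `IsDirectSum v R fam` — «`R ≃ ⊕_χ fam χ`», a canonical isomorphism of representations of `U(V)(F_v)` with the
  direct sum of the family over ALL `χ`. -/
structure LocalOscillatorDataSum extends LocalOscillatorData where
  IsZero : ∀ v, Rep v → Prop
  IsFieldAt : Place → Prop
  IsAnisotropicAt : Place → Prop
  chiCheckEqMuSq : ∀ v, Triple v → Prop
  Pair : Place → Type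
  pairOf : ∀ v, Triple v → Pair v
  CentralChar : Place → Type
  withChar : ∀ v, Pair v → CentralChar v → Triple v
  omegaPair : ∀ v, Pair v → Rep v
  IsDirectSum : ∀ v, Rep v → (CentralChar v → Rep v) → Prop

/-- **[L21] Lemma D.1 (1)** (print p. 125 L29), VERBATIM: «(1) `ω(μ, ε, χ)` is zero if and only if `E` is a field, `V`
is anisotropic (in particular `n = 2`), and `χ̌ = μ²`.»  (`F` nonarchimedean — the standing hypothesis of the lemma,
print p. 125 L28.)  The parenthetical «in particular `n = 2`» is typed as the conjunct `D.n = 2` of the right-hand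
side: on the page it is asserted as part of the characterisation (a consequence of the anisotropy under the standing
`n ≥ 2`), so the typed «only if» direction yields `n = 2` from vanishing — what `ne_zero_of_three_le` uses — and the
typed «if» direction asks for `n = 2` in addition to the anisotropy, never more than the page asserts. -/
def Liu2021_LemmaD1_1 (D : LocalOscillatorDataSum) : Prop :=
  ∀ (v : D.Place), D.IsNonarch v → ∀ t : D.Triple v,
    D.IsZero v (D.omega v t) ↔ (D.IsFieldAt v ∧ D.IsAnisotropicAt v ∧ D.n = 2 ∧ D.chiCheckEqMuSq v t)

/-- The consequence L3.3e consumes (t4-plan-3 S12509): for `n ≥ 3` NO local oscillator representation vanishes — at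
every nonarchimedean place, split or not.  (Arithmetic on the typed iff; nothing about the page is proved.) -/
theorem Liu2021_LemmaD1_1.ne_zero_of_three_le {D : LocalOscillatorDataSum} (h : Liu2021_LemmaD1_1 D)
    (h3 : 3 ≤ D.n) (v : D.Place) (hv : D.IsNonarch v) (t : D.Triple v) : ¬ D.IsZero v (D.omega v t) := by
  intro hz
  have h2 : D.n = 2 := ((h v hv t).1 hz).2.2.1
  omega

/-- **[L21] Appendix D.1, the display in the proof of Lemma D.1** (print p. 126 L22–L27), VERBATIM: «Note that, since
`E^1` is compact, we have a canonical isomorphism of representations of `U(V)` `ω(μ, ε) ≃ ⊕_χ ω(μ, ε, χ)`.» — the sum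
over ALL characters `χ : E^1 → ℂ^1`; by Step 3 (print p. 125 L24–L25: `ω(μ, ε, χ)` is «the maximal quotient of the
representation `ω(ε, μ)` of `U(V)` with central character `χ`») each summand is the `χ`-isotypic part of `ω(μ, ε)` under
the centre `E^1` of `U(V)`.  Printed inside the proof of Lemma D.1, whose standing hypothesis is `F` nonarchimedean —
typed with that hypothesis.  SCOPE (bus S12505): this is the representation of the pair `(U(V), U(W))` with
`dim_E W = 1` (Step 1: `Mp(V_ε)`, `V_ε` the symplectic `F`-space underlying `V`), not the `S(V)`-model of a split
two-dimensional `W`, whose central-isotypic pieces are sums of tensor products of two such summands. -/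
def Liu2021_D1_directSum (D : LocalOscillatorDataSum) : Prop :=
  ∀ (v : D.Place), D.IsNonarch v → ∀ p : D.Pair v,
    D.IsDirectSum v (D.omegaPair v p) (fun χ => D.omega v (D.withChar v p χ))

end Summit.Ventures.HodgeRepro.Tier4.Lit

end
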